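import Literature.NumberTheory.EllipticCurves.Rank1Residual.X11RankOneCertificates.Schema
import HarnessLib

/-!
# Class X11a (multiplicative `p`, `E[p]` irreducible, analytic rank `0`, no (ram) prime) — PRINT-route certificate records: the record schema and its in-kernel recheck

Topic `NumberTheory/EllipticCurves`; namespace
`Literature.NumberTheory.EllipticCurves.Rank1Residual.X11aPrintCertificates` (= this directory).
Cell `bsd-print-x11a` (D-0131 (2) print tier), typer seat ty3: "certificate-record schema + per-class
display files — the finite certificate data the provers' discharges consume; two-engine where numeric".

This file fixes the FORMAT in which the per-pair data of the residual class
**X11a** (`ClassX11a W p := W.analyticRank = 0 ∧ p ≠ 2 ∧ Mult W p ∧ Irr W p ∧ ¬ Ram W p`, the tree's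
`Summits/BirchSwinnertonDyer/Rank1Residual/Partition/Rows.lean` = RESIDUAL-CASES §a.2 v5 row X11a: an
ODD prime `p ‖ N` with `E[p]` irreducible and NO second multiplicative prime `q ≠ p` at which `E[p]` is
ramified, `ord_{s=1} L(E,s) = 0`) enter the tree as DATA, one record per (Cremona isogeny class, prime),
in the sibling display files `Records*.lean` of this directory (one file per sub-cell batch; each states
`Certified [r₁, …]` and is proved by `decide`, i.e. by the kernel re-running `Record.check` on the literal
data). Nothing here is a named fact and nothing is asserted about elliptic curves: what a record CLAIMS
about its curve, in the tree's vocabulary (`Mult`, `Irr`, `Ram`, `Surj`, `shaAn`, …), is the `Prop`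
`Record.Claim` of the sibling file `Claim.lean` (to be taken as a hypothesis, D-0014 style — exactly as
`X11RankOneCertificates/{Schema,Claim}.lean` and `KuriharaCertificates/{Schema,Claim}.lean` do), and
`Claim.lean` proves which PUBLISHED named facts turn the claim into Miller's `BSD(E,p)` on which sub-cell.
The arithmetic helpers (`powMod`, `natVal`, `isPrimeBelow504100`, `legendreSym`, `invariants`, `c4Of`,
`c6Of`, `discOf`, `countPoints`, `apNaive`, `strictlyIncreasing`) are REUSED from
`X11RankOneCertificates.Schema` (same kernel semantics, so the same Summits-side bridges — e.g. the
point-count bridge `Supersingular.countPoints_eq_of_fast` — read these records); only a square-and-multiply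
`powModFast` / `legendreFast` is added here, because X11a's prime `p` is unbounded (`p = N` for every
irreducible prime-conductor curve: `11a1 @ 11`, `37b1 @ 37`, …) and Euler's criterion mod such `p` by
`p/2` repeated multiplications would not reduce in the kernel.

## The sub-cells of X11a a record is filed under (`Record.cellOf`, RECHECKED against `cell`)

As in `Summits/…/X11a/Cells.lean` + `X11a/EndState.lean` (the class's statement of record and end
state): `Three` (`p = 3`; typed domain `X11ThreeRankZero.MissingInputAt` of x11b/x11c), `Pub`
(`p ≥ 5`, `ρ̄_{E,p}` surjective, `p ∤ #Ш(E/ℚ)_an` — CLOSED IN PRINT per pair by Wuthrich, Doc. Math. 19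
(2014) Prop. 21 + Gross–Zagier–Kolyvagin, tree theorem
`Rank1Residual.bsdp_of_classX11_rankZero_surj_of_shaAn_unit`; `Claim.lean` instantiates it on a record),
`LeafSurj` (`p ≥ 5`, surjective, `p ∣ #Ш_an`: per-pair input = the certificate `μ^an(E,p) = 0`,
`X11a.MuAnZeroAt`; class level = Greenberg's `μ`-conjecture for irreducible `E[p]` = barrier B3),
`LeafNonSurj` (`p ≥ 5`, irreducible NON-surjective image — `5S4`, `5Ns`: per-pair input = Mazur's main
conjecture at the pair, `X2.MazurMainConjectureAt`). The `Three` records additionally carry the same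
image / `#Ш_an` data, so that the `p = 3` unit sub-population (`surj(3) ∧ 3 ∤ #Ш_an`, also closed per
pair by Wuthrich Prop. 21 at an odd prime) is visible.

## What a record records, and what the kernel rechecks (`Record.check`, decidable)

For the curve `label` (Cremona; curve number 1 of its isogeny class; reduced global minimal model
`ainvs = [a₁,a₂,a₃,a₄,a₆]`) and the prime `p`:
* `bad = [(q, v_q(N), v_q(Δ)), …]` for every bad prime `q` (increasing). RECHECKED (as in
  `X11RankOneCertificates`): every `q` prime (trial division, `q < 710²`), `conductor = ∏ q^{v_q(N)}`,
  `|Δ(ainvs)| = ∏ q^{v_q(Δ)}` with `Δ` RECOMPUTED from the a-invariants (so the listed primes are exactly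
  the primes of `Δ`, hence contain every multiplicative prime), and for listed `q ≥ 5`: `v_q(N) ≤ 2`,
  `v_q(N) = 1 ↔ q ∤ c₄` (Tate / Néron: multiplicative iff `q ∣ Δ`, `q ∤ c₄` on a minimal model);
* the CLASS SHAPE of X11a: `p` an odd prime, `v_p(N) = 1`, `v_p(Δ) > 0`, `p ∤ c₄(ainvs)`
  (multiplicative at `p`); `rank = 0`, `rootNumber = +1`; `isogDegrees` (Cremona `allisog`, `1`
  included) has no degree divisible by `p` (no rational `p`-isogeny ⇒ `E[p]` irreducible — the CLAIM
  `Irr`) AND an irreducibility WITNESS `irrWitness = [(ℓ, a_ℓ), …] ≠ []`: good odd primes `ℓ < 64`,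
  `ℓ ∤ Np`, `a_ℓ` RECOMPUTED by point counting, with `X² − a_ℓX + ℓ` root-free mod `p`, i.e.
  `(a_ℓ² − 4ℓ | p) = −1` (a reducible `E[p]` has `Frob_ℓ`-eigenvalues `φ(ℓ), ψ(ℓ) ∈ 𝔽_p`; Mazur 1978
  §5–§6); **no (ram) witness**: every listed `q ≠ p` with `v_q(N) = 1` has `p ∣ v_q(Δ)` (`¬ Ram W p`,
  Skinner–Urban's (ram) NEGATED — this is what puts the pair outside the covered row C1 = Skinner 2016
  Thm. C);
* the LOCAL TYPE at `p`: `split` (`a_p = +1`) / `¬split` (`a_p = −1`), RECHECKED as `(−c₆ | p) = +1`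
  (Silverman *AEC* VII.5.1 (b)); `cp = c_p` RECHECKED as `v_p(Δ)` (split, Tate) resp. `1`/`2` for
  `v_p(Δ)` odd/even (non-split; Kodaira `I_n`, Tate's algorithm); `finiteAtP r = (p ∣ v_p(Δ))` (DERIVED:
  `E[p]` finite flat at `p` = "peu ramifié" ⇔ `p ∣ v_p(Δ_min)`; the precondition of Ribet's level
  LOWERING at `p` used by the visibility road, and — negated, `p ∤ v_p(Δ)` — Serre's valuation criterion
  for a transvection in inertia);
* the IMAGE at `p`: `image` = `"surj"` or the Sutherland/Cremona `galrep` code (`5S4`, `5Ns`, `3Nn`, …);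
  a claimed surjective image must come with a CERTIFICATE SOURCE (`Record.surjSource`): the valuation
  criterion (`p ∤ v_p(Δ)`: with `E[p]` irreducible and `p` odd, `ρ̄_{E,p}` is onto — Serre 1972 §1.12 +
  §2.4 Prop. 15 / §2.8; tree theorem `X11b.surj_of_mult_of_irr_of_not_dvd`), Serre-criterion witnesses
  `serre = [(ℓ₁,a₁),(ℓ₂,a₂),(ℓ₃,a₃)]` (Serre 1972 Prop. 19, `p ≥ 5`; RECHECKED verbatim as in
  `X11RankOneCertificates.Record.checkSerre`, `aᵢ` recomputed), semistability read off `bad` (Serre §5.4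
  Prop. 21 i), tree `Rank1Residual.surj_of_irr_of_semistable`) or `11 ≤ p` (BDMTV 2019, tree
  `ClassX11a.surj_of_eleven_le`, fact-binder `hB`); a non-surjective / uncertified `image` must have
  `serre = []`, `p ∣ v_p(Δ)`, non-square-free `N` and `p < 11` (consistency — ty2's shape
  `ClassX11a.not_surj_shape`); the Fouquet-3.4 bit `fouquet34` (multiplicative `q ≠ p` odd, Kummer clause
  at `q ≡ 1 (mod p)`: `u_q/c₄³` no `p`-th power mod `q`) is RECHECKED against `fouquet34Of`;
* the BSD NUMERICS (two engines, see `engines`): `torsion = #E(ℚ)_tors`, `tamagawa = ∏_q c_q`,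
  `lRatio = (num, den)` with `L(E,1)/Ω_E = num/den` (`Ω_E` the Néron real period `∫_{E(ℝ)}|ω|`, Miller's
  convention), `shaAn = #Ш(E/ℚ)_an ∈ ℕ`. RECHECKED: the exact identity
  `num · torsion² = shaAn · tamagawa · den` (the rank-`0` BSD formula AS AN IDENTITY BETWEEN THE RECORDED
  NUMBERS — it ties the engines' outputs, it does not prove any of them), `cp ∣ tamagawa`, `p ∤ torsion`
  (automatic from `Irr`, Mazur), all positive; `ordpShaAn r = v_p(shaAn)` and `ordpTam r = v_p(tamagawa)`
  are DERIVED;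
* the ROAD DATA of the print cell's four provers (all OPTIONAL lists, each entry RECHECKED):
  `levelRaising = [(q₀, a_{q₀}, ε), …]` — level-raising primes for the congruence road (p2): `q₀ < 64`
  an odd prime, `q₀ ∤ Np`, `a_{q₀}` RECOMPUTED, `ε = ±1`, `p ∣ a_{q₀} − ε(q₀+1)` (Ribet's condition;
  Diamond–Taylor 1994 Thm. A); `twists = [d, …]` — quadratic discriminants for the non-split
  exceptional-zero road (p3): `d ≡ 0, 1 (mod 4)`, `d ∉ {0, 1}`, `gcd(d, N) = 1` (so unramified at `p`
  and at every bad prime) and `(d | p) = −1` (the twist `E^{(d)}` is SPLIT multiplicative at `p`; only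
  for `split = false`); `partners = [⟨kind, label_F, ainvs_F, N_F, rank_F, points, [(ℓ, a_ℓ(E), a_ℓ(F)), …], sturm⟩, …]` —
  `p`-congruent curves for the visibility / Fouquet / level-raising roads (p4/p2): `Δ(ainvs_F) ≠ 0`,
  every listed integral projective point lies ON `F` (RECHECKED; independence = engine claim), and at
  every listed good odd `ℓ < 64`, `ℓ ∤ N·N_F·p`, BOTH traces RECOMPUTED and `a_ℓ(E) ≡ a_ℓ(F) (mod p)`
  (a finite sample; the congruence up to the Sturm / Kraus–Oesterlé bound `sturm` is the engines' CLAIM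
  and `E[p] ≅ F[p]` a CLAIM); `mu = [⟨n, u, [(a, x_num,
  x_den), …]⟩, …]` — `μ^an(E,p) = 0` witnesses (barrier-B3 door, end-state input (2) of
  `X11a/EndState.lean`): the plus modular symbols `x⁺{∞, a/pⁿ} = x_num/x_den` (PARI `msfromell`
  normalisation) over ONE Teichmüller coset `{a mod pⁿ : a^{p−1} ≡ u^{p−1}}` (`p − 1` residues, distinct
  mod `p`, RECHECKED by `powModFast`), all `x_den` prime to `p`, and `∑ x_num·x_den⁻¹ ≢ 0 (mod p)` — since
  `μ_E(a + pⁿℤ_p) = a_p^{−n}[a/pⁿ]⁺` at `p ‖ N` (Mazur–Tate–Teitelbaum §I.10), this coset sum is, up to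
  the unit `a_p^{−n}` and the period-normalisation constant, the mass of a ball of the cyclotomic
  (trivial tame character) measure, so its being a unit forces `μ(L_p(E,T)) = 0`; the normalisation and
  the identification with the tree's `MuAnZeroAt` are CLAIM-level (`Claim.lean`), the arithmetic is
  rechecked here;
* `cell` ∈ {`"Three"`, `"Pub"`, `"LeafSurj"`, `"LeafNonSurj"`}, RECHECKED against `Record.cellOf`
  (computed from `p`, `image`, `v_p(shaAn)`); `routes` = names of the per-pair kernel theorems of record
  that already close the pair (documentation; e.g. `X11a.WuthrichUnit1.…`, `X11b.bsdp_s118080ds1`);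
  `engines` = provenance strings (engine T = Cremona `ecdata` tables `allbsd/allisog/galrep`; engine K =
  the naive recomputation of this schema; engine P = PARI/GP kit job; engine S = Sage/eclib kit job),
  documentation only.

NOT checked here (they are CLAIMS about the curve, `Claim.lean`): that the model is globally minimal,
that `N` is the conductor, the analytic rank `0`, `#Ш_an`, `#E(ℚ)_tors`, `∏c_q`, the Galois-theoretic
statements (irreducible / surjective / `¬ram` as statements about `ρ̄_{E,p}`, which the kernel reads off
the RECHECKED numerics through the tree's bridges on the Summits side), the isogeny `E[p] ≅ F[p]` for a
partner, and the identification of the `mu` coset sum with a coefficient of `ϖ·L_p(E,T)`.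

## Design

As `X11RankOneCertificates/Schema.lean`: plain computable data (`ℕ`, `ℤ`, `Bool`, `String`, `List`), no
Mathlib structures, naive arithmetic, so that `decide` runs the recheck inside the kernel (no
`native_decide`, no extra axioms); `Certified rs` is a `Bool` equation with a `Decidable` instance.

References: J.-P. Serre, Invent. Math. 15 (1972) §1.12, §2.4 Prop. 15, §2.8 Prop. 19
[SerreInventiones1972]; B. Mazur, Invent. Math. 44 (1978) §5–§6 [Mazur1978]; J. H. Silverman, *AEC*
VII.5.1, C.15 (Tate's algorithm) [SilvermanAEC2009]; C. Skinner, E. Urban, Invent. Math. 195 (2014) (ram)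
[SkinnerUrban2014]; C. Skinner, Pacific J. Math. 283 (2016) Thm. C [Skinner2016PacificMC]; C. Wuthrich,
Doc. Math. 19 (2014) Prop. 21 [Wuthrich2014]; B. Mazur, J. Tate, J. Teitelbaum, Invent. Math. 84 (1986)
§I.10 [MazurTateTeitelbaum1986Invent]; R. Greenberg, V. Vatsal, Invent. Math. 142 (2000) [GreenbergVatsal2000];
F. Diamond, R. Taylor, Invent. Math. 115 (1994) Thm. A [DiamondTaylor1994]; A. Agashe, W. Stein, J. Number
Theory 97 (2002) Thm. 3.1 [AgasheStein2002]; R. L. Miller, LMS J. Comput. Math. 14 (2011) Def. 1.1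
[Miller2011LMS]; J. E. Cremona, the elliptic curve database [Cremona2006]; tree files
`Summits/BirchSwinnertonDyer/Rank1Residual/X11a/{Cells,EndState,MuLambdaSplit}.lean` (statement of record,
end state, `MuAnZeroAt`), `Literature/…/Rank1Residual/X11.lean` (the Wuthrich route).
-/

namespace Literature.NumberTheory.EllipticCurves.Rank1Residual.X11aPrintCertificates

open X11RankOneCertificates (powMod natVal isPrimeBelow504100 strictlyIncreasing legendreSym invariants
  c4Of c6Of discOf countPoints apNaive)

/-! ### Fast modular exponentiation (the prime `p` of an X11a pair is unbounded) -/

/-- `b ^ e mod m` by square-and-multiply with structural fuel (`fuel` halvings of `e`; `64` suffices for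
every `e < 2⁶⁴`); `m = 0` is junk-free (`% 0` is the identity). [folklore] -/
def powModFastAux : ℕ → ℕ → ℕ → ℕ → ℕ
  | 0, _, _, m => 1 % m
  | fuel + 1, b, e, m =>
    if e = 0 then 1 % m
    else
      let h := powModFastAux fuel b (e / 2) m
      if e % 2 = 1 then h * h % m * b % m else h * h % m

/-- `b ^ e mod m` for `e < 2⁶⁴` (square-and-multiply, kernel-evaluable for `m` up to Cremona's range and
beyond). [folklore] -/
def powModFast (b e m : ℕ) : ℕ := powModFastAux 64 (b % m) e m

/-- The Legendre symbol `(a | ℓ)` for an odd prime `ℓ` by Euler's criterion with `powModFast`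
(`0` if `ℓ ∣ a`). Same values as `X11RankOneCertificates.legendreSym`, usable for large `ℓ`. [folklore] -/
def legendreFast (a : ℤ) (ℓ : ℕ) : ℤ :=
  let r := (a % (ℓ : ℤ)).toNat
  if r = 0 then 0 else if powModFast r ((ℓ - 1) / 2) ℓ = 1 then 1 else -1

/-- The inverse of `d` modulo a PRIME `p` by Fermat (`d^{p−2} mod p`; junk if `p ∣ d`). [folklore] -/
def invModFast (p d : ℕ) : ℕ := powModFast (d % p) (p - 2) p

/-! ### The record -/

/-- A `p`-congruent PARTNER curve `F` of the record's curve `E` (visibility / congruence roads): label,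
a-invariants, conductor, Mordell–Weil rank (Cremona), and trace samples `(ℓ, a_ℓ(E), a_ℓ(F))` at good odd
primes `ℓ < 64`. The congruence `E[p] ≅ F[p]` itself is a CLAIM; the samples are rechecked.
[cite: AgasheStein2002, Thm. 3.1 (the congruence datum of a visibility pair)] [cite: Cremona2006, §2 (labels, a-invariants, ranks)] -/
structure Partner where
  /-- the road the partner serves: `"visibility"` (rank-`2` `p`-congruent curve, Agashe–Stein / Cremona–Mazur),
  `"fouquet"` (good-ordinary-at-`p` `p`-congruent curve with big image, Fouquet 2025 + BCS seed), `"levelraised"`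
  (a `p`-congruent curve or form of level `Nq₀`), or free text. -/
  kind : String
  /-- Cremona label of the partner curve `F`. -/
  label : String
  /-- a-invariants of `F` (reduced minimal model). -/
  ainvs : List ℤ
  /-- conductor `N_F`. -/
  conductor : ℕ
  /-- Mordell–Weil rank of `F(ℚ)` (Cremona; `≥ 2` for a visibility partner). -/
  rank : ℕ
  /-- explicit rational points of `F` as INTEGRAL PROJECTIVE triples `(x, y, z)` (generators, Cremona `allgens`),
  RECHECKED to lie on `F`; their independence is an engine claim. -/
  points : List (ℤ × ℤ × ℤ)
  /-- trace samples `(ℓ, a_ℓ(E), a_ℓ(F))`, both RECOMPUTED by `Record.check`. -/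
  congr : List (ℕ × ℤ × ℤ)
  /-- the bound `B` up to which the engines verified `a_ℓ(E) ≡ a_ℓ(F) (mod p)` for all good `ℓ ≤ B`
  (Sturm / Kraus–Oesterlé; `0` = not run). Engine claim, not rechecked. -/
  sturm : ℕ
  deriving DecidableEq

/-- A `μ^an(E,p) = 0` WITNESS at a multiplicative prime: level `n ≥ 1`, coset representative `u`
(`p ∤ u`), and the plus modular symbols `x⁺{∞, a/pⁿ} = num/den` for the `p − 1` residues `a mod pⁿ` of
the Teichmüller coset of `u` (`a^{p−1} ≡ u^{p−1} (mod pⁿ)`). `Record.check` rechecks the coset and that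
the sum is a `p`-adic unit; what the sum IS (a ball mass of the Mazur–Tate–Teitelbaum measure) is
`Claim.lean`'s business. [cite: MazurTateTeitelbaum1986Invent, §I.10 (the measure at p ∣ N)] -/
structure MuWitness where
  /-- the level `n ≥ 1` (balls `⟨u⟩(1 + pⁿℤ_p)` of `Γ = 1 + pℤ_p`). -/
  n : ℕ
  /-- a representative `u` of the coset, `0 < u < pⁿ`, `p ∤ u`. -/
  u : ℕ
  /-- `(a, num, den)`: `x⁺{∞, a/pⁿ} = num/den` for each `a` in the coset of `u`. -/
  symbols : List (ℕ × ℤ × ℕ)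
  deriving DecidableEq

/-- One certificate record of class X11a: the DATA of one (Cremona isogeny class, prime) pair, see the
module docstring for the meaning of each field. A record asserts nothing by itself; `Record.check` is its
decidable recheck. [cite: Cremona2006, §2–§3 (the tabulated invariants: a-invariants, N, isogeny degrees, #E(ℚ)_tors, ∏c_q, L(E,1)/Ω, #Ш_an, image codes)]
[cite: Miller2011LMS, Def. 1.1 (BSD(E,p) and #Ш_an)] -/
structure Record where
  /-- Cremona label of the curve (curve number 1 of its isogeny class, e.g. `"11a1"`). -/
  label : String
  /-- a-invariants `[a₁, a₂, a₃, a₄, a₆]` of the reduced global minimal model. -/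
  ainvs : List ℤ
  /-- the conductor `N`. -/
  conductor : ℕ
  /-- the prime `p` (odd, `p ‖ N`). -/
  p : ℕ
  /-- `(q, v_q(N), v_q(Δ_min))` for every bad prime `q`, increasing in `q`. -/
  bad : List (ℕ × ℕ × ℕ)
  /-- `true` = split multiplicative at `p` (`a_p = +1`), `false` = non-split (`a_p = −1`). -/
  split : Bool
  /-- Fouquet 2025 Assumption 3.4 in Tate form at the multiplicative primes `q ≠ p` (road p2, ty2's binder `h34`):
  every such `q` is odd and, when `q ≡ 1 (mod p)`, `u_q / c₄³` is not a `p`-th power in `𝔽_q^×`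
  (`u_q = Δ_min / q^{v_q(Δ_min)}`). RECHECKED against `Record.fouquet34Of`. -/
  fouquet34 : Bool
  /-- degrees of the rational isogenies from the curve (Cremona `allisog`), `1` included. -/
  isogDegrees : List ℕ
  /-- irreducibility witnesses `(ℓ, a_ℓ)`: `X² − a_ℓX + ℓ` has no root mod `p`; at least one. -/
  irrWitness : List (ℕ × ℤ)
  /-- `"surj"` or the Sutherland/Cremona image code of `ρ̄_{E,p}` (`"5S4"`, `"5Ns"`, `"3Nn"`, …). -/
  image : String
  /-- Serre-criterion witnesses `[(ℓ₁,a_ℓ₁),(ℓ₂,a_ℓ₂),(ℓ₃,a_ℓ₃)]` (types s₁, s₂, s₃), or `[]`. -/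
  serre : List (ℕ × ℤ)
  /-- `#E(ℚ)_tors`. -/
  torsion : ℕ
  /-- the Tamagawa product `∏_q c_q`. -/
  tamagawa : ℕ
  /-- the Tamagawa number `c_p` at `p`. -/
  cp : ℕ
  /-- the global root number. -/
  rootNumber : ℤ
  /-- the Mordell–Weil rank (Cremona) = the analytic rank (engines). -/
  rank : ℕ
  /-- `L(E,1)/Ω_E = num/den` (`Ω_E` = Néron real period, all components). -/
  lRatio : ℤ × ℕ
  /-- the analytic order of `Ш` (an integer; engines agree). -/
  shaAn : ℕ
  /-- level-raising primes `(q₀, a_{q₀}, ε)` with `p ∣ a_{q₀} − ε(q₀+1)` (road p2); may be `[]`. -/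
  levelRaising : List (ℕ × ℤ × ℤ)
  /-- quadratic discriminants `d` with `gcd(d, N) = 1`, `(d | p) = −1` (road p3, non-split `p`); may be `[]`. -/
  twists : List ℤ
  /-- `p`-congruent partner curves (roads p2/p4); may be `[]`. -/
  partners : List Partner
  /-- `μ^an(E,p) = 0` witnesses (barrier-B3 door); may be `[]`. -/
  mu : List MuWitness
  /-- the sub-cell of X11a: `"Three"`, `"Pub"`, `"LeafSurj"` or `"LeafNonSurj"`. -/
  cell : String
  /-- per-pair kernel theorems of record closing this pair (documentation). -/
  routes : List String
  /-- provenance strings (engines, jobs); documentation only. -/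
  engines : List String
  deriving DecidableEq

/-! ### The recheck -/

namespace Record

variable (r : Record)

/-- `v_q(N)` as recorded in `bad` (`0` if `q` is not listed). [folklore] -/
def vN (q : ℕ) : ℕ := ((r.bad.find? fun t => t.1 == q).map fun t => t.2.1).getD 0
/-- `v_q(Δ)` as recorded in `bad` (`0` if `q` is not listed). [folklore] -/
def vD (q : ℕ) : ℕ := ((r.bad.find? fun t => t.1 == q).map fun t => t.2.2).getD 0

/-- DERIVED: `v_p(#Ш_an)`. [folklore] -/
def ordpShaAn : ℕ := natVal r.p r.shaAn
/-- DERIVED: `v_p(∏ c_q)`. [folklore] -/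
def ordpTam : ℕ := natVal r.p r.tamagawa
/-- DERIVED: `E[p]` is finite flat at `p` ("peu ramifié"): `p ∣ v_p(Δ_min)`. The level-lowering
precondition at `p` (Ribet); its negation is Serre's valuation criterion for surjectivity.
[cite: SerreInventiones1972, §1.12 (ρ̄ on the Tate curve) and §2.8] -/
def finiteAtP : Bool := r.vD r.p % r.p == 0
/-- DERIVED: surjectivity of `ρ̄_{E,p}` is certified by the valuation criterion `p ∤ v_p(Δ_min)` (with
`E[p]` irreducible, `p` odd, `p ‖ N`). [cite: SerreInventiones1972, §1.12 and §2.4 Prop. 15] -/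
def surjByValuation : Bool := !r.finiteAtP
/-- DERIVED: the curve is semistable according to the data (`v_q(N) = 1` at every bad prime). [folklore] -/
def semistableData : Bool := r.bad.all (fun t => t.2.1 == 1)
/-- DERIVED: the SOURCE certifying a surjective `ρ̄_{E,p}` for an irreducible `E[p]` at `p ‖ N`, in this order:
`"valuation"` (`p ∤ v_p(Δ_min)`, Serre §1.12 + §2.4 Prop. 15; tree `X11b.surj_of_mult_of_irr_of_not_dvd`),
`"serre"` (Prop. 19 witnesses recorded), `"semistable"` (Serre §5.4 Prop. 21 i): semistable + irreducible ⇒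
surjective, every `p`; tree `Rank1Residual.surj_of_irr_of_semistable`), `"eleven"` (`11 ≤ p`: an irreducible
non-surjective image at `p ‖ N` forces `p ∈ {5, 7}` — Balakrishnan–Dogra–Müller–Tuitman–Vonk 2019 with Serre,
tree `ClassX11a.surj_of_eleven_le`, a named-fact binder `hB`), else `"none"`.
[cite: SerreInventiones1972, §1.12, §2.4 Prop. 15, §2.8 Prop. 19, §5.4 Prop. 21] -/
def surjSource : String :=
  if r.surjByValuation then "valuation"
  else if !r.serre.isEmpty then "serre"
  else if r.semistableData then "semistable"
  else if 11 ≤ r.p then "eleven"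
  else "none"
/-- `u_q / c₄³ mod q` is NOT a `p`-th power in `𝔽_q^×` (for `q ≡ 1 (mod p)`: `(u_q c₄⁻³)^{(q−1)/p} ≢ 1`), where
`u_q = Δ / q^{v_q(Δ)}` is the prime-to-`q` part of the (minimal) discriminant — the Kummer clause of Fouquet's
Assumption 3.4 in Tate form (the Tate parameter of `E/ℚ_q` has unit part `≡ u_q / c₄³`). [folklore] -/
def kummerClause (q vD : ℕ) : Bool :=
  let D := discOf r.ainvs
  let uq : ℤ := D / ((q : ℤ) ^ vD)
  let w : ℕ := (uq % (q : ℤ)).toNat * invModFast q (((c4Of r.ainvs) ^ 3 % (q : ℤ)).toNat) % q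
  powModFast w ((q - 1) / r.p) q != 1
/-- DERIVED: Fouquet 2025 Assumption 3.4 (Tate form) at the multiplicative primes `q ≠ p` of the data: each is
odd, and satisfies the Kummer clause when `q ≡ 1 (mod p)` (ty2's binder `h34` of
`X11a/PrintDischargeFouquet.lean`). [folklore] -/
def fouquet34Of : Bool :=
  r.bad.all (fun t => decide (t.1 = r.p) || !(t.2.1 == 1) ||
    (decide (t.1 ≠ 2) && (!(t.1 % r.p == 1) || r.kummerClause t.1 t.2.2)))

/-- Shape and support (verbatim the `X11RankOneCertificates` check): five a-invariants; bad primes prime,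
increasing; `N = ∏ q^{v_q(N)}`; `|Δ(ainvs)| = ∏ q^{v_q(Δ)}` (RECOMPUTED discriminant); every listed `q`
has `v_q(Δ) > 0`; and for listed `q ≥ 5`: `v_q(N) ≤ 2`, `v_q(N) = 1 ↔ q ∤ c₄`.
[cite: SilvermanAEC2009, Prop. VII.5.1] -/
def checkSupport : Bool :=
  (r.ainvs.length == 5) &&
  r.bad.all (fun t => isPrimeBelow504100 t.1 && decide (0 < t.2.2)) &&
  strictlyIncreasing (r.bad.map (·.1)) &&
  ((r.bad.map fun t => t.1 ^ t.2.1).foldl (· * ·) 1 == r.conductor) &&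
  (((r.bad.map fun t => t.1 ^ t.2.2).foldl (· * ·) 1 : ℕ) == (discOf r.ainvs).natAbs) &&
  decide (discOf r.ainvs ≠ 0) &&
  r.bad.all (fun t => decide (t.1 < 5) ||
    (decide (t.2.1 ≤ 2) && ((t.2.1 == 1) == decide (c4Of r.ainvs % (t.1 : ℤ) ≠ 0))))

/-- The CLASS SHAPE of X11a read off the data: `p` an odd prime with `v_p(N) = 1`, `p ∣ Δ`, `p ∤ c₄`
(multiplicative at `p`); `rank = 0`, root number `+1`; no rational `p`-isogeny (`1 ∈ isogDegrees`,
`p ∤ d`); at least one irreducibility witness `(ℓ, a_ℓ)` — `ℓ` an odd prime `< 64`, `ℓ ∤ Np`, `a_ℓ`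
RECOMPUTED, `(a_ℓ² − 4ℓ | p) = −1`; and NO (ram) witness: every listed `q ≠ p` with `v_q(N) = 1` has
`p ∣ v_q(Δ)`. [cite: Mazur1978, §5 (p. 148) and §6 Prop. 6.3] [cite: SkinnerUrban2014, Thm. 2 (ram)] -/
def checkClass : Bool :=
  decide (3 ≤ r.p) && isPrimeBelow504100 r.p && (r.vN r.p == 1) && decide (0 < r.vD r.p) &&
  decide (c4Of r.ainvs % (r.p : ℤ) ≠ 0) &&
  (r.rank == 0) && (r.rootNumber == 1) &&
  r.isogDegrees.contains 1 && r.isogDegrees.all (fun d => decide (d % r.p ≠ 0)) &&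
  !r.irrWitness.isEmpty &&
  r.irrWitness.all (fun w =>
    decide (3 ≤ w.1) && decide (w.1 < 64) && isPrimeBelow504100 w.1 && decide (r.conductor % w.1 ≠ 0) &&
    decide (w.1 ≠ r.p) && (apNaive r.ainvs w.1 == w.2) &&
    (legendreFast (w.2 * w.2 - 4 * (w.1 : ℤ)) r.p == -1)) &&
  r.bad.all (fun t => decide (t.1 = r.p) || !(t.2.1 == 1) || (t.2.2 % r.p == 0))

/-- The LOCAL TYPE at `p`: split iff `(−c₆ | p) = +1`; `c_p = v_p(Δ)` (split) resp. `2`/`1` for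
`v_p(Δ)` even/odd (non-split); and the recorded Fouquet-3.4 bit is the computed one.
[cite: SilvermanAEC2009, Prop. VII.5.1 (b) and Table C.15.1 (Iₙ)] -/
def checkLocal : Bool :=
  (r.split == (legendreFast (-(c6Of r.ainvs)) r.p == 1)) &&
  (r.cp == (if r.split then r.vD r.p else if r.vD r.p % 2 == 0 then 2 else 1)) &&
  (r.fouquet34 == r.fouquet34Of)

/-- Serre's criterion (Prop. 19) on the three witnesses `(ℓᵢ, aᵢ)` (verbatim the `X11RankOneCertificates`
conditions, `aᵢ` RECOMPUTED; `legendreFast` mod `p`), demanded only when `serre ≠ []`, and then `p ≥ 5`.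
[cite: SerreInventiones1972, §2.8 Prop. 19] -/
def checkSerre : Bool :=
  match r.serre with
  | [] => true
  | [(l1, t1), (l2, t2), (l3, t3)] =>
    let p : ℤ := r.p
    let ok (l : ℕ) (t : ℤ) : Bool :=
      decide (3 ≤ l) && decide (l < 64) && isPrimeBelow504100 l && decide (r.conductor % l ≠ 0) &&
        decide (l ≠ r.p) && (apNaive r.ainvs l == t)
    let sq (d : ℤ) : ℤ := legendreFast d r.p
    let d1 := t1 * t1 - 4 * l1
    let d2 := t2 * t2 - 4 * l2
    let u := (t3 * t3 % p) * (invModFast r.p (l3 % r.p) : ℤ) % p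
    decide (5 ≤ r.p) && ok l1 t1 && ok l2 t2 && ok l3 t3 &&
      decide (d1 % p ≠ 0) && (sq d1 == 1) && decide (t1 % p ≠ 0) &&
      (sq d2 == -1) && decide (t2 % p ≠ 0) &&
      decide (u ≠ 0 ∧ u ≠ 1 ∧ u ≠ 2 ∧ u ≠ 4 % p) && decide ((u * u - 3 * u + 1) % p ≠ 0)
  | _ => false

/-- The IMAGE consistency: a claimed surjective image carries a certificate SOURCE (`surjSource ≠ "none"`);
a non-surjective (or uncertified) image code carries no Serre witnesses and is peu ramifié, non-semistable and
at `p < 11` (the only shape an irreducible non-surjective image at `p ‖ N` can have).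
[cite: SerreInventiones1972, §1.12, §2.4 Prop. 15, §2.8 Prop. 19, §5.4 Prop. 21] -/
def checkImage : Bool :=
  r.checkSerre &&
  (if r.image == "surj" then r.surjSource != "none"
   else r.serre.isEmpty && r.finiteAtP && !r.semistableData && decide (r.p < 11))

/-- The BSD NUMERICS: all positive, `p ∤ #E(ℚ)_tors`, `c_p ∣ ∏ c_q`, and the exact rank-`0` identity
`num · #tors² = #Ш_an · ∏c_q · den` between the recorded numbers (`L(E,1)/Ω_E = num/den`).
[cite: Miller2011LMS, Def. 1.1 (the quantity #Ш_an)] -/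
def checkBSD : Bool :=
  decide (0 < r.torsion) && decide (0 < r.tamagawa) && decide (0 < r.cp) && decide (0 < r.shaAn) &&
  decide (0 < r.lRatio.2) && decide (r.torsion % r.p ≠ 0) && (r.tamagawa % r.cp == 0) &&
  (r.lRatio.1 * ((r.torsion : ℤ) * r.torsion) == (r.shaAn : ℤ) * r.tamagawa * r.lRatio.2)

/-- The sub-cell computed from the data: `p = 3` ⇒ `Three`; else non-surjective image ⇒ `LeafNonSurj`;
else `p ∤ #Ш_an` ⇒ `Pub`; else `LeafSurj` (as `X11a/Cells.lean`, `X11a/EndState.lean`). [folklore] -/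
def cellOf : String :=
  if r.p = 3 then "Three"
  else if r.image ≠ "surj" then "LeafNonSurj"
  else if r.ordpShaAn = 0 then "Pub" else "LeafSurj"

/-- ROAD p2 — level-raising primes: each `(q₀, a, ε)` has `q₀` an odd prime `< 64`, `q₀ ∤ Np`, `a = a_{q₀}`
RECOMPUTED, `ε = ±1`, `p ∣ a − ε(q₀ + 1)`. [cite: DiamondTaylor1994, Thm. A (Ribet's condition a_q ≡ ±(q+1))] -/
def checkLevelRaising : Bool :=
  r.levelRaising.all (fun t =>
    decide (3 ≤ t.1) && decide (t.1 < 64) && isPrimeBelow504100 t.1 && decide (r.conductor % t.1 ≠ 0) &&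
    decide (t.1 ≠ r.p) && (apNaive r.ainvs t.1 == t.2.1) && decide (t.2.2 = 1 ∨ t.2.2 = -1) &&
    ((t.2.1 - t.2.2 * ((t.1 : ℤ) + 1)) % (r.p : ℤ) == 0))

/-- ROAD p3 — quadratic twists making a NON-split `p` split: each `d ≡ 0, 1 (mod 4)`, `d ∉ {0, 1}`,
`gcd(d, N) = 1`, `(d | p) = −1`; and the list is empty unless `split = false`. [folklore] -/
def checkTwists : Bool :=
  (r.twists.isEmpty || !r.split) &&
  r.twists.all (fun d =>
    decide (d ≠ 0 ∧ d ≠ 1) && decide (d % 4 = 0 ∨ d % 4 = 1) && (Nat.gcd d.natAbs r.conductor == 1) &&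
    (legendreFast d r.p == -1))

/-- An integral projective point `(x, y, z) ≠ (0,0,0)` lies on `[a₁,a₂,a₃,a₄,a₆]`:
`y²z + a₁xyz + a₃yz² = x³ + a₂x²z + a₄xz² + a₆z³`. [cite: SilvermanAEC2009, III.1 (Weierstrass equation)] -/
def onCurve (a : List ℤ) (P : ℤ × ℤ × ℤ) : Bool :=
  match a, P with
  | [a1, a2, a3, a4, a6], (x, y, z) =>
    decide ((x, y, z) ≠ (0, 0, 0)) &&
    (y * y * z + a1 * x * y * z + a3 * y * z * z == x * x * x + a2 * x * x * z + a4 * x * z * z + a6 * z * z * z)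
  | _, _ => false

/-- ROADS p2/p4 — partners: `Δ(ainvs_F) ≠ 0`, `N_F > 0`, every listed point lies on `F`, and every trace sample `(ℓ, a, b)` has `ℓ` an odd
prime `< 64`, `ℓ ∤ N·N_F`, `ℓ ≠ p`, `a = a_ℓ(E)`, `b = a_ℓ(F)` RECOMPUTED, `a ≡ b (mod p)`; at least one
sample per partner. [cite: AgasheStein2002, Thm. 3.1 (the congruence input of visibility)] -/
def checkPartners : Bool :=
  r.partners.all (fun F =>
    (F.ainvs.length == 5) && decide (discOf F.ainvs ≠ 0) && decide (0 < F.conductor) &&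
    F.points.all (onCurve F.ainvs) &&
    !F.congr.isEmpty &&
    F.congr.all (fun t =>
      decide (3 ≤ t.1) && decide (t.1 < 64) && isPrimeBelow504100 t.1 &&
      decide (r.conductor % t.1 ≠ 0) && decide (F.conductor % t.1 ≠ 0) && decide (t.1 ≠ r.p) &&
      (apNaive r.ainvs t.1 == t.2.1) && (apNaive F.ainvs t.1 == t.2.2) &&
      ((t.2.1 - t.2.2) % (r.p : ℤ) == 0)))

/-- BARRIER-B3 DOOR — `μ^an = 0` witnesses: for each, `1 ≤ n`, `0 < u < pⁿ`, `p ∤ u`, exactly `p − 1`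
symbols whose arguments `a` are `< pⁿ`, pairwise distinct mod `p`, and satisfy `a^{p−1} ≡ u^{p−1} (mod pⁿ)`
(the Teichmüller coset of `u`), every denominator prime to `p`, and `∑ num · den⁻¹ ≢ 0 (mod p)`.
[cite: MazurTateTeitelbaum1986Invent, §I.10 (μ(a + pⁿℤ_p) = α⁻ⁿ[a/pⁿ] at p ∣ N)] -/
def checkMu : Bool :=
  r.mu.all (fun w =>
    let pn := r.p ^ w.n
    let target := powModFast w.u (r.p - 1) pn
    decide (1 ≤ w.n) && decide (0 < w.u) && decide (w.u < pn) && decide (w.u % r.p ≠ 0) &&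
    (w.symbols.length == r.p - 1) &&
    w.symbols.all (fun s => decide (s.1 < pn) && (powModFast s.1 (r.p - 1) pn == target) &&
      decide (s.2.2 % r.p ≠ 0)) &&
    (let residues := w.symbols.map (fun s => s.1 % r.p)
     decide (residues.Nodup)) &&
    (((w.symbols.map fun s =>
        (s.2.1 % (r.p : ℤ)).toNat * invModFast r.p (s.2.2 % r.p) % r.p).foldl (· + ·) 0) % r.p != 0))

/-- The full recheck of a record (conjunction of the checks above and of `cell = cellOf`). [folklore] -/
def check : Bool :=
  r.checkSupport && r.checkClass && r.checkLocal && r.checkImage && r.checkBSD &&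
  (r.cell == r.cellOf) && r.checkLevelRaising && r.checkTwists && r.checkPartners && r.checkMu

end Record

/-- A list of records is `Certified` when every one passes `Record.check`; this is the statement of each
generated theorem `theorem certified… : Certified [ … ] := by decide` of the files `Records*.lean`.
[cite: Cremona2006, §3 (the database entries, here rechecked in the kernel)] -/
def Certified (rs : List Record) : Prop := rs.all Record.check = true

/-- `Certified rs` is decidable (a `Bool` equation). [folklore] -/
instance Certified.instDecidable (rs : List Record) : Decidable (Certified rs) :=
  inferInstanceAs (Decidable (rs.all Record.check = true))

/-- Unpacking `Certified`: every listed record passes the recheck. [cite: Cremona2006, §3 (database entries)] -/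
theorem Certified.check_of_mem {rs : List Record} (h : Certified rs) {r : Record} (hr : r ∈ rs) :
    r.check = true :=
  List.all_eq_true.1 h r hr

/-! ### Projections of a passing recheck (the facts `Claim.lean` consumes) -/

namespace Record

variable (r : Record)

/-- Projection: the class-shape check holds (the X11a hypotheses `p` odd, `p ‖ N`, irr, ¬(ram) as data).
[cite: Skinner2016PacificMC, Thm. C (hypotheses (i)–(ii), here with (ii) = (ram) negated)] -/
theorem checkClass_of_check (h : r.check = true) : r.checkClass = true := by
  simp only [check, Bool.and_eq_true] at h
  exact h.1.1.1.1.1.1.1.1.2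

/-- Projection: the image check holds (Serre's criteria as data). [cite: SerreInventiones1972, §2.8 Prop. 19 and §1.12] -/
theorem checkImage_of_check (h : r.check = true) : r.checkImage = true := by
  simp only [check, Bool.and_eq_true] at h
  exact h.1.1.1.1.1.1.2

/-- Projection: the BSD-numerics check holds (Miller's `#Ш_an` identity between the recorded numbers).
[cite: Miller2011LMS, Def. 1.1] -/
theorem checkBSD_of_check (h : r.check = true) : r.checkBSD = true := by
  simp only [check, Bool.and_eq_true] at h
  exact h.1.1.1.1.1.2

/-- Projection: the recorded sub-cell is the computed one (sub-cells of `X11a/Cells.lean`; the unit sub-cell is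
Wuthrich's Prop. 21 domain). [cite: Wuthrich2014, Prop. 21 (p. 400)] -/
theorem cell_eq_cellOf_of_check (h : r.check = true) : r.cell = r.cellOf := by
  simp only [check, Bool.and_eq_true, beq_iff_eq] at h
  exact h.1.1.1.1.2

/-- A passing record has `3 ≤ p` and `rank = 0` (Skinner 2016 Thm. C's standing `p ≥ 3`, `L(E,1) ≠ 0`).
[cite: Skinner2016PacificMC, Thm. C (p ≥ 3, rank 0)] -/
theorem three_le_of_check (h : r.check = true) : 3 ≤ r.p ∧ r.rank = 0 := by
  have h' := r.checkClass_of_check h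
  simp only [checkClass, Bool.and_eq_true, decide_eq_true_eq, beq_iff_eq] at h'
  exact ⟨h'.1.1.1.1.1.1.1.1.1.1.1, h'.1.1.1.1.1.1.2⟩

/-- A passing record has `p ≠ 2` (X11a is an odd-prime class). [cite: Skinner2016PacificMC, Thm. C (p ≥ 3)] -/
theorem p_ne_two_of_check (h : r.check = true) : r.p ≠ 2 := by
  have := (r.three_le_of_check h).1
  omega

/-- A passing record has `0 < shaAn` and `p ∤ torsion` (Miller's `#Ш_an > 0`; no rational `p`-torsion at an
irreducible `p`, Mazur). [cite: Miller2011LMS, Def. 1.1] [cite: Mazur1978, §6 Prop. 6.3] -/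
theorem shaAn_pos_of_check (h : r.check = true) : 0 < r.shaAn ∧ ¬ r.p ∣ r.torsion := by
  have h' := r.checkBSD_of_check h
  simp only [checkBSD, Bool.and_eq_true, decide_eq_true_eq] at h'
  exact ⟨h'.1.1.1.1.2, fun hd => h'.1.1.2 (Nat.mod_eq_zero_of_dvd hd)⟩

/-- On the sub-cell `Pub` the data read: `p ≠ 3`, surjective image code, `v_p(#Ш_an) = 0` — the per-pair
hypotheses of Wuthrich's Prop. 21 route. [cite: Wuthrich2014, Prop. 21 (p. 400)] -/
theorem pub_data_of_check (h : r.check = true) (hc : r.cell = "Pub") :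
    r.p ≠ 3 ∧ r.image = "surj" ∧ r.ordpShaAn = 0 := by
  have hco := r.cell_eq_cellOf_of_check h
  rw [hc] at hco
  unfold cellOf at hco
  by_cases h3 : r.p = 3
  · rw [if_pos h3] at hco
    exact absurd hco (by decide)
  · rw [if_neg h3] at hco
    by_cases hi : r.image = "surj"
    · rw [if_neg (fun hne => hne hi)] at hco
      by_cases ho : r.ordpShaAn = 0
      · exact ⟨h3, hi, ho⟩
      · rw [if_neg ho] at hco
        exact absurd hco (by decide)
    · rw [if_pos hi] at hco
      exact absurd hco (by decide)

/-- One unfolding of the fuelled valuation: if `natValAux (fuel+1) q n = 0` then no division step was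
possible. [folklore] -/
private theorem natValAux_succ_eq_zero {fuel q n : ℕ} (h : X11RankOneCertificates.natValAux (fuel + 1) q n = 0) :
    q < 2 ∨ n = 0 ∨ n % q ≠ 0 := by
  rw [X11RankOneCertificates.natValAux.eq_2] at h
  by_cases hc : q < 2 ∨ n = 0 ∨ n % q ≠ 0
  · exact hc
  · rw [if_neg hc] at h
    exact absurd h (Nat.succ_ne_zero _)

/-- On the sub-cell `Pub`, `p ∤ #Ш_an` (from `v_p(#Ш_an) = 0` and `0 < #Ш_an`) — the shape
`padicValRat p #Ш_an = 0` consumed by `Rank1Residual.bsdp_of_classX11_rankZero_surj_of_shaAn_unit`.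
[cite: Wuthrich2014, Prop. 21 (p. 400)] [cite: Miller2011LMS, Def. 1.1] -/
theorem not_dvd_shaAn_of_pub (h : r.check = true) (hc : r.cell = "Pub") : ¬ r.p ∣ r.shaAn := by
  obtain ⟨-, -, ho⟩ := r.pub_data_of_check h hc
  have hpos := (r.shaAn_pos_of_check h).1
  have hp := (r.three_le_of_check h).1
  intro hd
  have hmod : r.shaAn % r.p = 0 := Nat.mod_eq_zero_of_dvd hd
  rcases natValAux_succ_eq_zero (fuel := 199) ho with h1 | h2 | h3
  · omega
  · omega
  · exact h3 hmod

end Record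

-- `decide` unfolds `List.foldl`/`List.all` over `List.range 710` (trial division) and `List.range ℓ` (point
-- counting, `ℓ < 64`); the default recursion depth is too small for these literal lists.
set_option maxRecDepth 100000

/-- SAMPLE (and regression test of the recheck): the record of `11a1 @ 11` — the first X11a pair
(`N = 11`, `p = N`: split multiplicative at `11`, `v₁₁(Δ) = 5` so `c₁₁ = 5`, `11 ∤ 5` ⇒ surjective by the
valuation criterion, irreducibility witness `ℓ = 13` (`a₁₃ = 4`, `(16 − 52 | 11) = −1`), no other bad prime
so `¬ram` vacuously, `#E(ℚ)_tors = 5`, `∏c = 5`, `L(E,1)/Ω = 1/5`, `#Ш_an = 1` ⇒ sub-cell `Pub`;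
level-raising prime `59` (`a₅₉ = 5 ≡ 59 + 1 (mod 11)`)) passes. Data: Cremona `allbsd`/`allisog`
(engine T), traces recomputed (engine K). [cite: Cremona2006, the elliptic curve database (curve 11a1)] -/
theorem certified_sample : Certified [
  { label := "11a1", ainvs := [0, -1, 1, -10, -20], conductor := 11, p := 11,
    bad := [(11, 1, 5)], split := true, fouquet34 := true, isogDegrees := [1, 5, 25], irrWitness := [(13, 4)],
    image := "surj", serre := [], torsion := 5, tamagawa := 5, cp := 5, rootNumber := 1, rank := 0,
    lRatio := (1, 5), shaAn := 1, levelRaising := [(59, 5, 1)], twists := [], partners := [], mu := [],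
    cell := "Pub", routes := [], engines := ["T:ecdata allbsd/allisog/galrep", "K:schema recheck"] } ] := by
  decide

/-- Tampering is caught: the same record filed under `LeafSurj` with `shaAn := 121` fails (the kernel finds
the BSD identity `1 · 25 ≠ 121 · 5 · 5` violated). [cite: Cremona2006, the elliptic curve database (curve 11a1)] -/
theorem not_certified_tampered : ¬ Certified [
  { label := "11a1", ainvs := [0, -1, 1, -10, -20], conductor := 11, p := 11,
    bad := [(11, 1, 5)], split := true, fouquet34 := true, isogDegrees := [1, 5, 25], irrWitness := [(13, 4)],
    image := "surj", serre := [], torsion := 5, tamagawa := 5, cp := 5, rootNumber := 1, rank := 0,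
    lRatio := (1, 5), shaAn := 121, levelRaising := [], twists := [], partners := [], mu := [],
    cell := "LeafSurj", routes := [], engines := [] } ] := by
  decide

end Literature.NumberTheory.EllipticCurves.Rank1Residual.X11aPrintCertificates
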